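import Summits.Ventures.Crystal3D.Theorems.StickyWulffConstantGenericWallFloorLineCountOffset
import HarnessLib

/-!
# Bond lines LEAVING a slab sample through one face: the lattice-free per-class INNER-FACE count

HONEST FRAMING. Part of the venture `Summits/Ventures/Crystal3D` (cell `crystal3d-full`), helper for the crux
`TextureLiminf` (stmt-Ventures-19483) of `route-Ventures-StickyWulffConstant`, registered line `TexShadow`
(planner cf-p1 gen 29, v6.17, DECISION (xlv′)/(xlv″): glue (a) «inner-face count» between lane F's fcc|fcc slab law
`CoaxialTwoSlabAdhesion` / lane G's `TwoSlabLedgerAt` and lane T's cell currency `BilayerWallAt`, whose right-hand side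
carries `½·innerBonds` instead of `φ·πρ²`).  Pure Euclidean geometry and counting in `ℝ³`; nothing about packings.
Rung credit only; F-C1 not moved.

The landed per-class count `lineCount_offset_window` (`…GenericWallFloorLineCountOffset`) bounds from below the number of
bond lines of one `⟨110⟩` class `W` that MEET a slab sample `{lo ≤ ⟪p,ν⟫ ≤ lo + R, lateral ≤ ρ}` of height `R ≥ 1`.
For the inner face of a clamped plate one needs instead the number of such lines whose LAST site below the face plane
`⟪·,ν⟫ = hi` lies in the sample — that site `p` has a bond `p ± W` BEYOND the face (`⟪p ± W, ν⟫ > hi`), and it lies in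
the thin layer `hi − |⟪W,ν⟫| < ⟪p,ν⟫ ≤ hi`, whose height `|⟪W,ν⟫|` may be `≪ 1`; so the mid-plane transversal of the
landed file (which needs window height `≥ 1`) is replaced by a FACE-PLANE transversal:

* `exists_int_top_below` — `ν` unit, `‖W‖ ≤ 1`, `⟪W,ν⟫ ≠ 0`, `ρ ≥ 1`, `lo + 1 ≤ hi`.  If the crossing point `Q` of the
  line `P₀ + ℝW` with the FACE plane `⟪·,ν⟫ = hi` has lateral norm `≤ ρ − 1`, then some INTEGER `t` puts `P₀ + tW` in
  the sample `{lo ≤ ⟪p,ν⟫ ≤ hi, ‖p‖² − ⟪p,ν⟫² ≤ ρ²}` with `⟪P₀ + tW + W, ν⟫ > hi` or `⟪P₀ + tW − W, ν⟫ > hi`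
  (`t = ⌊s⌋` or `⌈s⌉` according to the sign of `⟪W,ν⟫`, `s` the real parameter of `Q`);
* `innerLineCount_offset` — **Theorem.** `ν` unit, `ρ ≥ 1`, `lo + 1 ≤ hi`; `Ea, Eb` of norm `≤ 1`, `W` unit with
  `det(Ea, Eb, W)² = 1/2`; `s` any offset.  If `T ⊆ ℤ²` contains every `(a, b)` for which some integer `t` puts
  `p = a•Ea + b•Eb + t•W + s` in the sample with `p + W` or `p − W` beyond the face, then
  `√2 |⟪W,ν⟫| π ρ² − 10 √2 π ρ ≤ #T` — the SAME constant as the landed meeting-count, uniform in `ν, s, lo, hi` and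
  the class, and with NO lower bound on the layer height `|⟪W,ν⟫|`: the crossings with the face plane form the affine
  lattice `c₀ + aX + bY` (`X, Y` the oblique projections), and `|⟪W,ν⟫|·(1 + ‖X‖ + ‖Y‖) ≤ 5` makes the shallow classes'
  slender cells harmless (shear identity `√2 |⟪W,ν⟫| |det| = 1`, affine disc count — verbatim the landed proof).

WHAT THIS IS NOT: no lattice enumeration, no deficiency, no `innerBonds` yet (that is the next file
`…TexShadowInnerFaceCount`); rung F-C1 not moved.
-/

noncomputable section

namespace Summit.Ventures.Crystal3D.Theorems

open Summit.Ventures.Crystal3D Matrix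
open scoped InnerProductSpace

/-- **Face-plane transversal.** `ν` unit, `‖W‖ ≤ 1`, `⟪W, ν⟫ ≠ 0`, `ρ ≥ 1`, `lo + 1 ≤ hi`.  If the crossing point
`Q = P₀ + sW` of the line `P₀ + ℝ W` with the face plane `⟪·, ν⟫ = hi` has lateral norm `≤ ρ − 1`, then for some
INTEGER `t` the point `P₀ + tW` lies in the slab sample `{lo ≤ ⟪p,ν⟫ ≤ hi, ‖p‖² − ⟪p,ν⟫² ≤ ρ²}` and one of its
two `W`-neighbours `P₀ + tW ± W` lies strictly beyond the face. -/
theorem exists_int_top_below (ν P₀ W : EuclideanSpace ℝ (Fin 3)) (hν : ‖ν‖ = 1)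
    (hW : ‖W‖ ≤ 1) (hα : ⟪W, ν⟫_ℝ ≠ 0) (ρ lo hi : ℝ) (hρ : 1 ≤ ρ) (hlo : lo + 1 ≤ hi)
    (hQ : ‖P₀ + ((hi - ⟪P₀, ν⟫_ℝ) / ⟪W, ν⟫_ℝ) • W‖ ^ 2 -
      ⟪P₀ + ((hi - ⟪P₀, ν⟫_ℝ) / ⟪W, ν⟫_ℝ) • W, ν⟫_ℝ ^ 2 ≤ (ρ - 1) ^ 2) :
    ∃ t : ℤ, lo ≤ ⟪P₀ + (t : ℝ) • W, ν⟫_ℝ ∧ ⟪P₀ + (t : ℝ) • W, ν⟫_ℝ ≤ hi ∧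
      ‖P₀ + (t : ℝ) • W‖ ^ 2 - ⟪P₀ + (t : ℝ) • W, ν⟫_ℝ ^ 2 ≤ ρ ^ 2 ∧
      (hi < ⟪P₀ + (t : ℝ) • W + W, ν⟫_ℝ ∨ hi < ⟪P₀ + (t : ℝ) • W - W, ν⟫_ℝ) := by
  set α : ℝ := ⟪W, ν⟫_ℝ with hαdef
  set s : ℝ := (hi - ⟪P₀, ν⟫_ℝ) / α with hs
  set Q : EuclideanSpace ℝ (Fin 3) := P₀ + s • W with hQdef
  -- the crossing point lies on the face plane
  have hQν : ⟪Q, ν⟫_ℝ = hi := by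
    rw [hQdef, inner_add_left, inner_smul_left, hs]
    simp only [conj_trivial]
    rw [← hαdef]
    field_simp
    ring
  -- |α| ≤ 1
  have hαle : |α| ≤ 1 := by
    have h := abs_real_inner_le_norm W ν
    rw [hν, mul_one] at h
    exact h.trans hW
  -- heights along the line
  have hheight : ∀ δ : ℝ, ⟪Q + δ • W, ν⟫_ℝ = hi + δ * α := by
    intro δ
    rw [inner_add_left, inner_smul_left, hQν]
    simp only [conj_trivial, ← hαdef]
  -- lateral control within unit parameter distance of the crossing
  have hlat : ∀ δ : ℝ, |δ| ≤ 1 → ‖Q + δ • W‖ ^ 2 - ⟪Q + δ • W, ν⟫_ℝ ^ 2 ≤ ρ ^ 2 := by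
    intro δ hδ
    rw [← norm_sub_inner_smul_sq ν _ hν]
    have hsplit : Q + δ • W - ⟪Q + δ • W, ν⟫_ℝ • ν =
        (Q - ⟪Q, ν⟫_ℝ • ν) + δ • (W - ⟪W, ν⟫_ℝ • ν) := by
      rw [inner_add_left, inner_smul_left]
      simp only [conj_trivial]
      rw [add_smul, smul_sub, smul_smul]
      abel
    rw [hsplit]
    have hρ1 : 0 ≤ ρ - 1 := by linarith
    have hlatQ : ‖Q - ⟪Q, ν⟫_ℝ • ν‖ ≤ ρ - 1 := by
      have h2 : ‖Q - ⟪Q, ν⟫_ℝ • ν‖ ^ 2 ≤ (ρ - 1) ^ 2 := by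
        rw [norm_sub_inner_smul_sq ν _ hν]; exact hQ
      exact (pow_le_pow_iff_left₀ (norm_nonneg _) hρ1 two_ne_zero).1 h2
    have hlatW : ‖W - ⟪W, ν⟫_ℝ • ν‖ ≤ 1 := by
      have h2 : ‖W - ⟪W, ν⟫_ℝ • ν‖ ^ 2 ≤ 1 ^ 2 := by
        rw [norm_sub_inner_smul_sq ν _ hν]
        have hW2 : ‖W‖ ^ 2 ≤ 1 := by nlinarith [norm_nonneg W]
        nlinarith [sq_nonneg ⟪W, ν⟫_ℝ]
      exact (pow_le_pow_iff_left₀ (norm_nonneg _) zero_le_one two_ne_zero).1 h2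
    have htri : ‖(Q - ⟪Q, ν⟫_ℝ • ν) + δ • (W - ⟪W, ν⟫_ℝ • ν)‖ ≤ ρ := by
      calc ‖(Q - ⟪Q, ν⟫_ℝ • ν) + δ • (W - ⟪W, ν⟫_ℝ • ν)‖
          ≤ ‖Q - ⟪Q, ν⟫_ℝ • ν‖ + ‖δ • (W - ⟪W, ν⟫_ℝ • ν)‖ := norm_add_le _ _
        _ = ‖Q - ⟪Q, ν⟫_ℝ • ν‖ + |δ| * ‖W - ⟪W, ν⟫_ℝ • ν‖ := by rw [norm_smul, Real.norm_eq_abs]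
        _ ≤ (ρ - 1) + 1 * 1 := by gcongr
        _ = ρ := by ring
    have h0 : 0 ≤ ‖(Q - ⟪Q, ν⟫_ℝ • ν) + δ • (W - ⟪W, ν⟫_ℝ • ν)‖ := norm_nonneg _
    nlinarith
  -- the integer points of the line, parametrised from the crossing
  have hP : ∀ t : ℤ, P₀ + (t : ℝ) • W = Q + ((t : ℝ) - s) • W := by
    intro t; rw [hQdef, add_assoc, ← add_smul]; congr 1; ring
  have hPp : ∀ t : ℤ, P₀ + (t : ℝ) • W + W = Q + ((t : ℝ) - s + 1) • W := by
    intro t; rw [hP]; simp only [add_smul, sub_smul, one_smul]; abel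
  have hPm : ∀ t : ℤ, P₀ + (t : ℝ) • W - W = Q + ((t : ℝ) - s - 1) • W := by
    intro t; rw [hP]; simp only [sub_smul, one_smul]; abel
  rcases lt_or_gt_of_ne hα with hneg | hpos
  · -- `α < 0`: take `t = ⌈s⌉`, so `δ = t − s ∈ [0, 1)` and `P₀ + tW − W` is beyond
    have hδ0 : 0 ≤ (⌈s⌉ : ℝ) - s := sub_nonneg.2 (Int.le_ceil s)
    have hδ1 : (⌈s⌉ : ℝ) - s < 1 := by have := Int.ceil_lt_add_one s; linarith
    refine ⟨⌈s⌉, ?_, ?_, ?_, Or.inr ?_⟩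
    · rw [hP, hheight]
      have : -1 ≤ ((⌈s⌉ : ℝ) - s) * α := by nlinarith [abs_le.1 hαle]
      linarith
    · rw [hP, hheight]
      nlinarith
    · rw [hP]; exact hlat _ (by rw [abs_of_nonneg hδ0]; exact hδ1.le)
    · rw [hPm, hheight]
      nlinarith
  · -- `α > 0`: take `t = ⌊s⌋`, so `δ = t − s ∈ (−1, 0]` and `P₀ + tW + W` is beyond
    have hδ0 : (⌊s⌋ : ℝ) - s ≤ 0 := sub_nonpos.2 (Int.floor_le s)
    have hδ1 : -1 < (⌊s⌋ : ℝ) - s := by have := Int.lt_floor_add_one s; linarith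
    refine ⟨⌊s⌋, ?_, ?_, ?_, Or.inl ?_⟩
    · rw [hP, hheight]
      have : -1 ≤ ((⌊s⌋ : ℝ) - s) * α := by nlinarith [abs_le.1 hαle]
      linarith
    · rw [hP, hheight]
      nlinarith
    · rw [hP]
      refine hlat _ ?_
      rw [abs_le]; constructor <;> linarith
    · rw [hPp, hheight]
      nlinarith

/-- **Per-class INNER-FACE line count with an offset (lattice-free).** `ν` unit, `ρ ≥ 1`, `lo + 1 ≤ hi`; `Ea, Eb` of
norm `≤ 1`, `W` unit, `det(Ea, Eb, W)² = 1/2`; `s` any offset.  If `T ⊆ ℤ²` contains every `(a, b)` for which some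
integer `t` puts `p = a•Ea + b•Eb + t•W + s` in the slab sample `{lo ≤ ⟪p,ν⟫ ≤ hi, ‖p‖² − ⟪p,ν⟫² ≤ ρ²}` with
`p + W` or `p − W` strictly beyond the face `⟪·,ν⟫ = hi`, then `√2 |⟪W,ν⟫| π ρ² − 10 √2 π ρ ≤ #T`. -/
theorem innerLineCount_offset (ν : EuclideanSpace ℝ (Fin 3)) (hν : ‖ν‖ = 1)
    (ρ lo hi : ℝ) (hρ1 : 1 ≤ ρ) (hlo : lo + 1 ≤ hi) (Ea Eb W s : EuclideanSpace ℝ (Fin 3))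
    (hEa : ‖Ea‖ ≤ 1) (hEb : ‖Eb‖ ≤ 1) (hW : ‖W‖ = 1)
    (hdet : (Matrix.det ![WithLp.ofLp Ea, WithLp.ofLp Eb, WithLp.ofLp W]) ^ 2 = 1 / 2)
    (T : Finset (ℤ × ℤ))
    (hT : ∀ a b t : ℤ,
      lo ≤ ⟪(a : ℝ) • Ea + (b : ℝ) • Eb + (t : ℝ) • W + s, ν⟫_ℝ →
      ⟪(a : ℝ) • Ea + (b : ℝ) • Eb + (t : ℝ) • W + s, ν⟫_ℝ ≤ hi →
      ‖(a : ℝ) • Ea + (b : ℝ) • Eb + (t : ℝ) • W + s‖ ^ 2 -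
          ⟪(a : ℝ) • Ea + (b : ℝ) • Eb + (t : ℝ) • W + s, ν⟫_ℝ ^ 2 ≤ ρ ^ 2 →
      (hi < ⟪(a : ℝ) • Ea + (b : ℝ) • Eb + (t : ℝ) • W + s + W, ν⟫_ℝ ∨
        hi < ⟪(a : ℝ) • Ea + (b : ℝ) • Eb + (t : ℝ) • W + s - W, ν⟫_ℝ) →
      (a, b) ∈ T) :
    Real.sqrt 2 * |⟪W, ν⟫_ℝ| * Real.pi * ρ ^ 2 - 10 * Real.sqrt 2 * Real.pi * ρ ≤ (T.card : ℝ) := by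
  have hρ0 : 0 ≤ ρ := by linarith
  have h2pos : 0 < Real.sqrt 2 := Real.sqrt_pos.2 (by norm_num)
  have h2sq : Real.sqrt 2 ^ 2 = 2 := Real.sq_sqrt (by norm_num)
  have hTnn : (0 : ℝ) ≤ (T.card : ℝ) := Nat.cast_nonneg _
  set α : ℝ := ⟪W, ν⟫_ℝ with hαdef
  set m : ℝ := hi with hmdef
  -- |α| ≤ 1, |⟪Ea,ν⟫| ≤ 1, |⟪Eb,ν⟫| ≤ 1
  have hαle : |α| ≤ 1 := by
    have h := abs_real_inner_le_norm W ν; rw [hW, hν, one_mul] at h; exact h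
  have hEaν : |⟪Ea, ν⟫_ℝ| ≤ 1 := by
    have h := abs_real_inner_le_norm Ea ν; rw [hν, mul_one] at h; exact h.trans hEa
  have hEbν : |⟪Eb, ν⟫_ℝ| ≤ 1 := by
    have h := abs_real_inner_le_norm Eb ν; rw [hν, mul_one] at h; exact h.trans hEb
  by_cases hα0 : α = 0
  · rw [hα0, abs_zero, mul_zero, zero_mul, zero_mul, zero_sub]
    have : 0 ≤ 10 * Real.sqrt 2 * Real.pi * ρ := by positivity
    linarith
  have hαpos : 0 < |α| := abs_pos.2 hα0
  -- the oblique projections and the (lateral) centre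
  set X : EuclideanSpace ℝ (Fin 3) := Ea - (⟪Ea, ν⟫_ℝ / α) • W with hX
  set Y : EuclideanSpace ℝ (Fin 3) := Eb - (⟪Eb, ν⟫_ℝ / α) • W with hY
  set c₀ : EuclideanSpace ℝ (Fin 3) := s + ((m - ⟪s, ν⟫_ℝ) / α) • W - m • ν with hc₀
  have hνν : ⟪ν, ν⟫_ℝ = 1 := by rw [real_inner_self_eq_norm_sq, hν, one_pow]
  have hXν : ⟪X, ν⟫_ℝ = 0 := by
    rw [hX, inner_sub_left, inner_smul_left]; simp only [conj_trivial]; rw [← hαdef]; field_simp; ring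
  have hYν : ⟪Y, ν⟫_ℝ = 0 := by
    rw [hY, inner_sub_left, inner_smul_left]; simp only [conj_trivial]; rw [← hαdef]; field_simp; ring
  have hc₀ν : ⟪c₀, ν⟫_ℝ = 0 := by
    rw [hc₀, inner_sub_left, inner_add_left, inner_smul_left, inner_smul_left]; simp only [conj_trivial]
    rw [hνν, ← hαdef]; field_simp; ring
  -- norms of X, Y: |α| ‖X‖ ≤ 2
  have hXn : |α| * ‖X‖ ≤ 2 := by
    have h1 : |α| * ‖X‖ = ‖α • Ea - ⟪Ea, ν⟫_ℝ • W‖ := by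
      rw [← Real.norm_eq_abs, ← norm_smul, hX, smul_sub, smul_smul, mul_div_cancel₀ _ hα0]
    rw [h1]
    have h2 : ‖α • Ea - ⟪Ea, ν⟫_ℝ • W‖ ≤ |α| * ‖Ea‖ + |⟪Ea, ν⟫_ℝ| * ‖W‖ := by
      calc ‖α • Ea - ⟪Ea, ν⟫_ℝ • W‖ ≤ ‖α • Ea‖ + ‖⟪Ea, ν⟫_ℝ • W‖ := norm_sub_le _ _
        _ = |α| * ‖Ea‖ + |⟪Ea, ν⟫_ℝ| * ‖W‖ := by
            rw [norm_smul, norm_smul, Real.norm_eq_abs, Real.norm_eq_abs]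
    rw [hW, mul_one] at h2
    nlinarith [abs_nonneg α, norm_nonneg Ea, abs_nonneg ⟪Ea, ν⟫_ℝ]
  have hYn : |α| * ‖Y‖ ≤ 2 := by
    have h1 : |α| * ‖Y‖ = ‖α • Eb - ⟪Eb, ν⟫_ℝ • W‖ := by
      rw [← Real.norm_eq_abs, ← norm_smul, hY, smul_sub, smul_smul, mul_div_cancel₀ _ hα0]
    rw [h1]
    have h2 : ‖α • Eb - ⟪Eb, ν⟫_ℝ • W‖ ≤ |α| * ‖Eb‖ + |⟪Eb, ν⟫_ℝ| * ‖W‖ := by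
      calc ‖α • Eb - ⟪Eb, ν⟫_ℝ • W‖ ≤ ‖α • Eb‖ + ‖⟪Eb, ν⟫_ℝ • W‖ := norm_sub_le _ _
        _ = |α| * ‖Eb‖ + |⟪Eb, ν⟫_ℝ| * ‖W‖ := by
            rw [norm_smul, norm_smul, Real.norm_eq_abs, Real.norm_eq_abs]
    rw [hW, mul_one] at h2
    nlinarith [abs_nonneg α, norm_nonneg Eb, abs_nonneg ⟪Eb, ν⟫_ℝ]
  set r : ℝ := ‖X‖ + ‖Y‖ with hr
  have hr0 : 0 ≤ r := by positivity
  have hαr : |α| * (1 + r) ≤ 5 := by rw [hr]; nlinarith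
  -- the small-ρ case is trivial
  by_cases hrρ : ρ - 1 < r
  · have h1 : |α| * ρ ≤ 5 := by nlinarith
    have h3 : 0 ≤ Real.sqrt 2 * Real.pi * ρ := by positivity
    have h4 : Real.sqrt 2 * |α| * Real.pi * ρ ^ 2 = (Real.sqrt 2 * Real.pi * ρ) * (|α| * ρ) := by
      ring
    have h5 : Real.sqrt 2 * |α| * Real.pi * ρ ^ 2 ≤ (Real.sqrt 2 * Real.pi * ρ) * 5 := by
      rw [h4]; exact mul_le_mul_of_nonneg_left h1 h3
    nlinarith
  push Not at hrρ
  -- plane coordinates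
  obtain ⟨A, β, hAβ, hdetA, hAf⟩ := exists_planeCoordinates ν X Y c₀ hν hXν hYν hc₀ν
  -- Gram identity ⇒ 2 α² det(A)² = 1
  have hgram := sq_mul_gram_shear_euclidean Ea Eb W ν hα0
  rw [← hαdef, ← hX, ← hY, hdet, hν, one_pow, mul_one, ← hdetA] at hgram
  have hdetabs : Real.sqrt 2 * |α| * |A.det| = 1 := by
    have hnn : 0 ≤ Real.sqrt 2 * |α| * |A.det| := by positivity
    have hsq : (Real.sqrt 2 * |α| * |A.det|) ^ 2 = 1 := by
      rw [mul_pow, mul_pow, h2sq, sq_abs, sq_abs]; linarith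
    exact (pow_eq_one_iff_of_nonneg hnn (by norm_num)).1 hsq
  have hAdet : A.det ≠ 0 := by
    intro h; rw [h, abs_zero, mul_zero] at hdetabs; exact zero_ne_one hdetabs
  -- the affine disc count
  have hbound : ∀ f : Fin 2 → ℝ, (∀ i, 0 ≤ f i ∧ f i < 1) →
      (A.mulVec f 0) ^ 2 + (A.mulVec f 1) ^ 2 ≤ r ^ 2 := by
    intro f hf
    rw [hAf]
    have h0 := hf 0; have h1 := hf 1
    have hle : ‖f 0 • X + f 1 • Y‖ ≤ r := by
      calc ‖f 0 • X + f 1 • Y‖ ≤ ‖f 0 • X‖ + ‖f 1 • Y‖ := norm_add_le _ _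
        _ = |f 0| * ‖X‖ + |f 1| * ‖Y‖ := by rw [norm_smul, norm_smul, Real.norm_eq_abs, Real.norm_eq_abs]
        _ ≤ 1 * ‖X‖ + 1 * ‖Y‖ := by
            gcongr
            · rw [abs_of_nonneg h0.1]; exact h0.2.le
            · rw [abs_of_nonneg h1.1]; exact h1.2.le
        _ = r := by rw [hr]; ring
    exact pow_le_pow_left₀ (norm_nonneg _) hle 2
  have hdisc := affine_disc_count A hAdet β 0 r (ρ - 1) hr0 hrρ hbound T ?_
  swap
  · intro i j hij
    simp only [Pi.zero_apply, sub_zero] at hij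
    -- the face-plane crossing of the line (i, j) has lateral norm ≤ ρ - 1
    have hlat : ‖c₀ + (i : ℝ) • X + (j : ℝ) • Y‖ ^ 2 ≤ (ρ - 1) ^ 2 := by rw [hAβ]; exact hij
    set P₀ : EuclideanSpace ℝ (Fin 3) := (i : ℝ) • Ea + (j : ℝ) • Eb + s with hP₀
    have hQ : ‖P₀ + ((hi - ⟪P₀, ν⟫_ℝ) / ⟪W, ν⟫_ℝ) • W‖ ^ 2 -
        ⟪P₀ + ((hi - ⟪P₀, ν⟫_ℝ) / ⟪W, ν⟫_ℝ) • W, ν⟫_ℝ ^ 2 ≤ (ρ - 1) ^ 2 := by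
      rw [← norm_sub_inner_smul_sq ν _ hν]
      have hP₀ν : ⟪P₀, ν⟫_ℝ = (i : ℝ) * ⟪Ea, ν⟫_ℝ + (j : ℝ) * ⟪Eb, ν⟫_ℝ + ⟪s, ν⟫_ℝ := by
        rw [hP₀, inner_add_left, inner_add_left, inner_smul_left, inner_smul_left]; simp
      have heq : P₀ + ((hi - ⟪P₀, ν⟫_ℝ) / ⟪W, ν⟫_ℝ) • W -
          ⟪P₀ + ((hi - ⟪P₀, ν⟫_ℝ) / ⟪W, ν⟫_ℝ) • W, ν⟫_ℝ • ν =
          c₀ + (i : ℝ) • X + (j : ℝ) • Y := by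
        have hin : ⟪P₀ + ((hi - ⟪P₀, ν⟫_ℝ) / ⟪W, ν⟫_ℝ) • W, ν⟫_ℝ = m := by
          rw [inner_add_left, inner_smul_left]; simp only [conj_trivial]; rw [← hαdef, hmdef]
          field_simp; ring
        rw [hin, hP₀ν, ← hαdef, hc₀, hX, hY, hP₀]
        have e1 : (hi - ((i : ℝ) * ⟪Ea, ν⟫_ℝ + (j : ℝ) * ⟪Eb, ν⟫_ℝ + ⟪s, ν⟫_ℝ)) / α =
            -((i : ℝ) * (⟪Ea, ν⟫_ℝ / α)) - (j : ℝ) * (⟪Eb, ν⟫_ℝ / α) + (m - ⟪s, ν⟫_ℝ) / α := by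
          rw [hmdef]; field_simp; ring
        rw [e1]
        module
      rw [heq]; exact hlat
    obtain ⟨t, ht1, ht2, ht3, ht4⟩ :=
      exists_int_top_below ν P₀ W hν hW.le hα0 ρ lo hi hρ1 hlo hQ
    have hpt : P₀ + (t : ℝ) • W = (i : ℝ) • Ea + (j : ℝ) • Eb + (t : ℝ) • W + s := by
      rw [hP₀]; abel
    rw [hpt] at ht1 ht2 ht3 ht4
    exact hT i j t ht1 ht2 ht3 ht4
  -- assemble: √2|α| π (ρ-1-r)² ≤ #T
  have hmain : Real.sqrt 2 * |α| * (Real.pi * (ρ - 1 - r) ^ 2) ≤ (T.card : ℝ) := by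
    have h := mul_le_mul_of_nonneg_left hdisc (by positivity : (0 : ℝ) ≤ Real.sqrt 2 * |α|)
    calc Real.sqrt 2 * |α| * (Real.pi * (ρ - 1 - r) ^ 2)
        ≤ Real.sqrt 2 * |α| * (|A.det| * (T.card : ℝ)) := h
      _ = (Real.sqrt 2 * |α| * |A.det|) * (T.card : ℝ) := by ring
      _ = (T.card : ℝ) := by rw [hdetabs, one_mul]
  -- (ρ-1-r)² ≥ ρ² - 2(1+r)ρ and |α|(1+r) ≤ 5
  have hexp : Real.sqrt 2 * |α| * Real.pi * ρ ^ 2 - 10 * Real.sqrt 2 * Real.pi * ρ ≤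
      Real.sqrt 2 * |α| * (Real.pi * (ρ - 1 - r) ^ 2) := by
    have e : Real.sqrt 2 * |α| * (Real.pi * (ρ - 1 - r) ^ 2) =
        Real.sqrt 2 * |α| * Real.pi * ρ ^ 2 - (2 * Real.sqrt 2 * Real.pi * ρ) * (|α| * (1 + r)) +
          Real.sqrt 2 * |α| * Real.pi * (1 + r) ^ 2 := by ring
    have h3 : (2 * Real.sqrt 2 * Real.pi * ρ) * (|α| * (1 + r)) ≤ (2 * Real.sqrt 2 * Real.pi * ρ) * 5 :=
      mul_le_mul_of_nonneg_left hαr (by positivity)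
    have h4 : 0 ≤ Real.sqrt 2 * |α| * Real.pi * (1 + r) ^ 2 := by positivity
    rw [e]
    linarith
  linarith

end Summit.Ventures.Crystal3D.Theorems

end
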